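import Summits.ValiantsHypothesis.ValiantsHypothesis.Theorems.KPlusLogSqLawValuativeDoorTopSets

/-!
# LINE `valuative_door` (crux `WeakLifting`, stmt-ValiantsHypothesis-19561) — TIE FAMILIES of an exchange system: Gale domination of the
# top tie and strict growth of the rank potential (abstract combinatorics for the valuated-matroid rung)

HONEST FRAMING.  Helper (cell `pub-symmetroid`, seat val-sym-lift-p1 g22, 2026-08-29; `--supports 19561 --as helper`).  Abstract setting of
the line's rank-one rung without the unit-minor hypothesis: a finite family `𝒮` of `m`-subsets of `Fin K` («supported sets»), log-weights
`a : Finset (Fin K) → ℝ`, slopes `d : Fin K → ℕ` (exponent of a set `E(S) = Σ_{l∈S} d l`), and the EXCHANGE AXIOM of a valuated matroid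
(Dress–Wenzel): for `A, B ∈ 𝒮` and `i ∈ A \ B` some `j ∈ B \ A` has `A − i + j, B − j + i ∈ 𝒮` and `a(A) + a(B) ≤ a(A−i+j) + a(B−j+i)`
(for the rank-one lacunary determinant this is `exchange_coeff_rankOnePencil` of `…ValuativeDoorExchange`).  At a slope `s` where
`M` bounds all lines `a(T) + s·E(T)`, the TIE FAMILY `{T ∈ 𝒮 : a(T) + s E(T) = M}` is again closed under symmetric exchange
(`tie_exchange`); its member `J` of LARGEST exponent GALE-DOMINATES every member `I`: for every threshold `θ`,
`#{l ∈ I : d l > θ} ≤ #{l ∈ J : d l > θ}` (`filter_card_le_of_tieMax`, induction on `#(J \ I)` exchanging from `J`'s side — each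
exchange trades a letter of `I` for a letter of LARGER slope); consequently the rank potential `Φ(S) = Σ_{l∈S} #{x : d x < d l}`
(the landed `…ValuativeDoorTopSets` currency) satisfies `Φ(I) < Φ(J)` for `I ≠ J` in the tie family when the slopes are distinct
(`rankPotential_lt_of_tieMax`, via `Φ(S) = Σ_x #{l ∈ S : d x < d l}`).  Pure finite combinatorics; nothing here is a stub of the line or
closes anything; no bearing on vW / vB, `TropicalB`, `MatrixDescartes` (18050) or VP ≠ VNP.  [elementary; Gale 1968 / Dress–Wenzel 1992 flavour]
-/

set_option linter.dupNamespace false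
set_option autoImplicit false

namespace Summit.ValiantsHypothesis.ValiantsHypothesis.Theorems.KPlusLogSqLaw.ValDoor

open Finset
open scoped BigOperators Classical

variable {K : ℕ}

/-! ## §1 Exchange bookkeeping -/

/-- the exponents of an exchanged pair add up to the same total. [bookkeeping] -/
theorem sum_exchange_add (d : Fin K → ℕ) {A B : Finset (Fin K)} {i j : Fin K} (hi : i ∈ A \ B) (hj : j ∈ B \ A) :
    ∑ l ∈ insert j (A.erase i), d l + ∑ l ∈ insert i (B.erase j), d l = ∑ l ∈ A, d l + ∑ l ∈ B, d l := by
  obtain ⟨hiA, hiB⟩ := Finset.mem_sdiff.1 hi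
  obtain ⟨hjB, hjA⟩ := Finset.mem_sdiff.1 hj
  have hj' : j ∉ A.erase i := fun h => hjA (Finset.mem_of_mem_erase h)
  have hi' : i ∉ B.erase j := fun h => hiB (Finset.mem_of_mem_erase h)
  rw [Finset.sum_insert hj', Finset.sum_insert hi', ← Finset.add_sum_erase A d hiA, ← Finset.add_sum_erase B d hjB]
  ring

/-- one exchanged set: `E(A − i + j) + d i = E(A) + d j`. [bookkeeping] -/
theorem sum_exchange_single (d : Fin K → ℕ) {A : Finset (Fin K)} {i j : Fin K} (hi : i ∈ A) (hj : j ∉ A) :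
    ∑ l ∈ insert j (A.erase i), d l + d i = ∑ l ∈ A, d l + d j := by
  have hj' : j ∉ A.erase i := fun h => hj (Finset.mem_of_mem_erase h)
  rw [Finset.sum_insert hj', ← Finset.add_sum_erase A d hi]
  ring

/-- an exchange preserves the cardinality. [bookkeeping] -/
theorem card_exchange {A : Finset (Fin K)} {i j : Fin K} (hi : i ∈ A) (hj : j ∉ A) :
    (insert j (A.erase i)).card = A.card := by
  have hj' : j ∉ A.erase i := fun h => hj (Finset.mem_of_mem_erase h)
  rw [Finset.card_insert_of_notMem hj', Finset.card_erase_of_mem hi]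
  have : 0 < A.card := Finset.card_pos.2 ⟨i, hi⟩
  omega

/-- `J \ (I − i + j) = (J \ I) − j` when `i ∉ J`. [bookkeeping] -/
theorem sdiff_exchange {I J : Finset (Fin K)} {i j : Fin K} (hiJ : i ∉ J) :
    J \ insert j (I.erase i) = (J \ I).erase j := by
  ext x
  simp only [Finset.mem_sdiff, Finset.mem_insert, Finset.mem_erase, not_or, not_and]
  constructor
  · rintro ⟨hxJ, hxj, hxI⟩
    refine ⟨hxj, hxJ, fun hxI' => ?_⟩
    have := hxI (fun h => hiJ (h ▸ hxJ))
    exact this hxI'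
  · rintro ⟨hxj, hxJ, hxI⟩
    exact ⟨hxJ, hxj, fun _ => hxI⟩

/-- **monotone exchange raises threshold counts:** trading `i ∈ I` for `j ∉ I` with `d i ≤ d j` does not decrease `#{l : θ < d l}`.
[bookkeeping: the map `i ↦ j`, identity elsewhere, is an injection of the filtered sets] -/
theorem filter_card_le_exchange (d : Fin K → ℕ) {I : Finset (Fin K)} {i j : Fin K} (hi : i ∈ I) (hj : j ∉ I) (hij : d i ≤ d j)
    (θ : ℕ) : (I.filter fun l => θ < d l).card ≤ ((insert j (I.erase i)).filter fun l => θ < d l).card := by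
  refine Finset.card_le_card_of_injOn (fun x => if x = i then j else x) (fun x hx => ?_) ?_
  · obtain ⟨hxI, hxθ⟩ := Finset.mem_filter.1 hx
    by_cases h : x = i
    · subst h
      simp only [if_true]
      exact Finset.mem_filter.2 ⟨Finset.mem_insert_self _ _, lt_of_lt_of_le hxθ hij⟩
    · simp only [if_neg h]
      exact Finset.mem_filter.2 ⟨Finset.mem_insert_of_mem (Finset.mem_erase.2 ⟨h, hxI⟩), hxθ⟩
  · intro x hx y hy hxy
    have hxI : x ∈ I := (Finset.mem_filter.1 (Finset.mem_coe.1 hx)).1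
    have hyI : y ∈ I := (Finset.mem_filter.1 (Finset.mem_coe.1 hy)).1
    by_cases hx' : x = i
    · by_cases hy' : y = i
      · rw [hx', hy']
      · simp only [hx', if_true, if_neg hy'] at hxy
        exact absurd hyI (hxy ▸ hj)
    · by_cases hy' : y = i
      · simp only [hy', if_true, if_neg hx'] at hxy
        exact absurd hxI (hxy.symm ▸ hj)
      · simpa only [if_neg hx', if_neg hy'] using hxy

/-! ## §2 The tie family of an exchange system at one slope -/

/-- **tie families are exchange-closed:** if `M` bounds every line `a(T) + s·E(T)` (`T ∈ 𝒮`) and `A`, `B` attain `M`, then for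
`i ∈ A \ B` the exchange partner `j` of the axiom gives two sets `A − i + j`, `B − j + i` that again attain `M` (their values add up to
at least `2M` and each is at most `M`). [elementary] -/
theorem tie_exchange (𝒮 : Finset (Finset (Fin K))) (a : Finset (Fin K) → ℝ) (d : Fin K → ℕ)
    (hX : ∀ A ∈ 𝒮, ∀ B ∈ 𝒮, ∀ i ∈ A \ B, ∃ j ∈ B \ A, insert j (A.erase i) ∈ 𝒮 ∧ insert i (B.erase j) ∈ 𝒮 ∧
      a A + a B ≤ a (insert j (A.erase i)) + a (insert i (B.erase j)))
    (s M : ℝ) (hmax : ∀ T ∈ 𝒮, a T + s * ((∑ l ∈ T, d l : ℕ) : ℝ) ≤ M)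
    {A B : Finset (Fin K)} (hA : A ∈ 𝒮) (hAM : a A + s * ((∑ l ∈ A, d l : ℕ) : ℝ) = M)
    (hB : B ∈ 𝒮) (hBM : a B + s * ((∑ l ∈ B, d l : ℕ) : ℝ) = M) {i : Fin K} (hi : i ∈ A \ B) :
    ∃ j ∈ B \ A, insert j (A.erase i) ∈ 𝒮 ∧ a (insert j (A.erase i)) + s * ((∑ l ∈ insert j (A.erase i), d l : ℕ) : ℝ) = M ∧
      insert i (B.erase j) ∈ 𝒮 ∧ a (insert i (B.erase j)) + s * ((∑ l ∈ insert i (B.erase j), d l : ℕ) : ℝ) = M := by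
  obtain ⟨j, hj, hA', hB', hle⟩ := hX A hA B hB i hi
  refine ⟨j, hj, hA', ?_, hB', ?_⟩ <;>
  · have h1 := hmax _ hA'
    have h2 := hmax _ hB'
    have hsum : ((∑ l ∈ insert j (A.erase i), d l : ℕ) : ℝ) + ((∑ l ∈ insert i (B.erase j), d l : ℕ) : ℝ)
        = ((∑ l ∈ A, d l : ℕ) : ℝ) + ((∑ l ∈ B, d l : ℕ) : ℝ) := by
      exact_mod_cast sum_exchange_add d hi hj
    have hs : s * ((∑ l ∈ insert j (A.erase i), d l : ℕ) : ℝ) + s * ((∑ l ∈ insert i (B.erase j), d l : ℕ) : ℝ)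
        = s * ((∑ l ∈ A, d l : ℕ) : ℝ) + s * ((∑ l ∈ B, d l : ℕ) : ℝ) := by
      rw [← mul_add, hsum, mul_add]
    linarith [hs, h1, h2, hle, hAM, hBM]

/-- **GALE DOMINATION BY THE TOP TIE:** in the tie family at slope `s`, the member `J` of largest exponent dominates every member `I`
threshold by threshold: `#{l ∈ I : θ < d l} ≤ #{l ∈ J : θ < d l}`.  Induction on `#(J \ I)`: exchange a letter `j ∈ J \ I` from `J`'s side;
the partner `i ∈ I \ J` has `d i ≤ d j` because `J − j + i` is a tie of exponent at most `E(J)`; `I − i + j` is a tie closer to `J` with no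
smaller threshold counts. [elementary; the matroid fact «the greedy base is Gale-maximal»] -/
theorem filter_card_le_of_tieMax (𝒮 : Finset (Finset (Fin K))) (a : Finset (Fin K) → ℝ) (d : Fin K → ℕ) (m : ℕ)
    (hcard : ∀ S ∈ 𝒮, S.card = m)
    (hX : ∀ A ∈ 𝒮, ∀ B ∈ 𝒮, ∀ i ∈ A \ B, ∃ j ∈ B \ A, insert j (A.erase i) ∈ 𝒮 ∧ insert i (B.erase j) ∈ 𝒮 ∧
      a A + a B ≤ a (insert j (A.erase i)) + a (insert i (B.erase j)))
    (s M : ℝ) (hmax : ∀ T ∈ 𝒮, a T + s * ((∑ l ∈ T, d l : ℕ) : ℝ) ≤ M)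
    {J : Finset (Fin K)} (hJ : J ∈ 𝒮) (hJM : a J + s * ((∑ l ∈ J, d l : ℕ) : ℝ) = M)
    (hJtop : ∀ T ∈ 𝒮, a T + s * ((∑ l ∈ T, d l : ℕ) : ℝ) = M → ∑ l ∈ T, d l ≤ ∑ l ∈ J, d l) :
    ∀ (n : ℕ) (I : Finset (Fin K)), I ∈ 𝒮 → a I + s * ((∑ l ∈ I, d l : ℕ) : ℝ) = M → (J \ I).card = n →
      ∀ θ : ℕ, (I.filter fun l => θ < d l).card ≤ (J.filter fun l => θ < d l).card := by
  intro n
  induction n with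
  | zero =>
    intro I hI _ h0 θ
    have hsub : J ⊆ I := by
      intro x hx
      by_contra hxI
      have : x ∈ J \ I := Finset.mem_sdiff.2 ⟨hx, hxI⟩
      rw [Finset.card_eq_zero.1 h0] at this
      exact Finset.notMem_empty x this
    have hJI : J = I := Finset.eq_of_subset_of_card_le hsub (by rw [hcard I hI, hcard J hJ])
    rw [hJI]
  | succ n ih =>
    intro I hI hIM hn θ
    obtain ⟨j, hj⟩ : (J \ I).Nonempty := Finset.card_pos.1 (by omega)
    obtain ⟨i, hi, hJ', hJ'M, hI', hI'M⟩ := tie_exchange 𝒮 a d hX s M hmax hJ hJM hI hIM hj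
    obtain ⟨hjJ, hjI⟩ := Finset.mem_sdiff.1 hj
    obtain ⟨hiI, hiJ⟩ := Finset.mem_sdiff.1 hi
    -- the partner has smaller slope: E(J − j + i) ≤ E(J)
    have hij : d i ≤ d j := by
      have h1 := hJtop _ hJ' hJ'M
      have h2 := sum_exchange_single d hjJ hiJ
      omega
    -- the exchanged tie I − i + j is closer to J
    have hn' : (J \ insert j (I.erase i)).card = n := by
      rw [sdiff_exchange hiJ, Finset.card_erase_of_mem hj]
      omega
    exact (filter_card_le_exchange d hiI hjI hij θ).trans (ih _ hI' hI'M hn' θ)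

/-! ## §3 The rank potential across a tie family -/

/-- the rank potential counted by thresholds: `Σ_{l∈S} #{x : d x < d l} = Σ_x #{l ∈ S : d x < d l}`. [bookkeeping: double counting] -/
theorem rankPotential_eq_sum_filter_card (d : Fin K → ℕ) (S : Finset (Fin K)) :
    ∑ l ∈ S, (univ.filter fun x => d x < d l).card = ∑ x : Fin K, (S.filter fun l => d x < d l).card := by
  simp only [Finset.card_filter]
  exact Finset.sum_comm

/-- **STRICT GROWTH OF THE RANK POTENTIAL ACROSS A TIE FAMILY:** with distinct slopes, the top tie `J` has strictly larger rank potential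
than every other member `I` of the tie family (threshold counts are dominated termwise by `filter_card_le_of_tieMax`, and at the
threshold just below the largest letter of `I △ J` — which must lie in `J` — the domination is strict). [elementary] -/
theorem rankPotential_lt_of_tieMax (𝒮 : Finset (Finset (Fin K))) (a : Finset (Fin K) → ℝ) (d : Fin K → ℕ)
    (hd : Function.Injective d) (m : ℕ) (hcard : ∀ S ∈ 𝒮, S.card = m)
    (hX : ∀ A ∈ 𝒮, ∀ B ∈ 𝒮, ∀ i ∈ A \ B, ∃ j ∈ B \ A, insert j (A.erase i) ∈ 𝒮 ∧ insert i (B.erase j) ∈ 𝒮 ∧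
      a A + a B ≤ a (insert j (A.erase i)) + a (insert i (B.erase j)))
    (s M : ℝ) (hmax : ∀ T ∈ 𝒮, a T + s * ((∑ l ∈ T, d l : ℕ) : ℝ) ≤ M)
    {J : Finset (Fin K)} (hJ : J ∈ 𝒮) (hJM : a J + s * ((∑ l ∈ J, d l : ℕ) : ℝ) = M)
    (hJtop : ∀ T ∈ 𝒮, a T + s * ((∑ l ∈ T, d l : ℕ) : ℝ) = M → ∑ l ∈ T, d l ≤ ∑ l ∈ J, d l)
    {I : Finset (Fin K)} (hI : I ∈ 𝒮) (hIM : a I + s * ((∑ l ∈ I, d l : ℕ) : ℝ) = M) (hne : I ≠ J) :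
    ∑ l ∈ I, (univ.filter fun x => d x < d l).card < ∑ l ∈ J, (univ.filter fun x => d x < d l).card := by
  have hdom : ∀ θ : ℕ, (I.filter fun l => θ < d l).card ≤ (J.filter fun l => θ < d l).card :=
    filter_card_le_of_tieMax 𝒮 a d m hcard hX s M hmax hJ hJM hJtop _ I hI hIM rfl
  -- both differences are nonempty (equal cardinalities, I ≠ J)
  have hcIJ : I.card = J.card := by rw [hcard I hI, hcard J hJ]
  have hIJ : (I \ J).Nonempty := by
    rw [Finset.nonempty_iff_ne_empty]
    intro h
    have hsub : I ⊆ J := Finset.sdiff_eq_empty_iff_subset.1 h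
    exact hne (Finset.eq_of_subset_of_card_le hsub hcIJ.ge)
  have hJI : (J \ I).Nonempty := by
    rw [Finset.nonempty_iff_ne_empty]
    intro h
    have hsub : J ⊆ I := Finset.sdiff_eq_empty_iff_subset.1 h
    exact hne (Finset.eq_of_subset_of_card_le hsub hcIJ.le).symm
  obtain ⟨imax, himax, himax_max⟩ := Finset.exists_max_image (I \ J) d hIJ
  obtain ⟨jmax, hjmax, hjmax_max⟩ := Finset.exists_max_image (J \ I) d hJI
  obtain ⟨himaxI, himaxJ⟩ := Finset.mem_sdiff.1 himax
  obtain ⟨hjmaxJ, hjmaxI⟩ := Finset.mem_sdiff.1 hjmax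
  have hneq : d imax ≠ d jmax := fun h => himaxJ (hd h ▸ hjmaxJ)
  -- the largest letter of I △ J lies in J: otherwise the threshold `d jmax` is dominated the wrong way
  have hlt : d imax < d jmax := by
    refine lt_of_le_of_ne (not_lt.1 fun hgt => ?_) hneq
    have hss : (J.filter fun l => d jmax < d l) ⊂ (I.filter fun l => d jmax < d l) := by
      rw [Finset.ssubset_iff_subset_ne]
      refine ⟨fun l hl => ?_, fun heq => ?_⟩
      · obtain ⟨hlJ, hlθ⟩ := Finset.mem_filter.1 hl
        refine Finset.mem_filter.2 ⟨?_, hlθ⟩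
        by_contra hlI
        exact absurd (hjmax_max l (Finset.mem_sdiff.2 ⟨hlJ, hlI⟩)) (not_le.2 hlθ)
      · have : imax ∈ (J.filter fun l => d jmax < d l) := heq ▸ Finset.mem_filter.2 ⟨himaxI, hgt⟩
        exact himaxJ (Finset.mem_filter.1 this).1
    exact absurd (hdom (d jmax)) (not_le.2 (Finset.card_lt_card hss))
  -- at the threshold `d imax` the domination is strict
  have hstrict : (I.filter fun l => d imax < d l).card < (J.filter fun l => d imax < d l).card := by
    refine Finset.card_lt_card ?_
    rw [Finset.ssubset_iff_subset_ne]
    refine ⟨fun l hl => ?_, fun heq => ?_⟩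
    · obtain ⟨hlI, hlθ⟩ := Finset.mem_filter.1 hl
      refine Finset.mem_filter.2 ⟨?_, hlθ⟩
      by_contra hlJ
      exact absurd (himax_max l (Finset.mem_sdiff.2 ⟨hlI, hlJ⟩)) (not_le.2 hlθ)
    · have : jmax ∈ (I.filter fun l => d imax < d l) := heq.symm ▸ Finset.mem_filter.2 ⟨hjmaxJ, hlt⟩
      exact hjmaxI (Finset.mem_filter.1 this).1
  rw [rankPotential_eq_sum_filter_card d I, rankPotential_eq_sum_filter_card d J]
  exact Finset.sum_lt_sum (fun x _ => hdom (d x)) ⟨imax, Finset.mem_univ _, hstrict⟩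

end Summit.ValiantsHypothesis.ValiantsHypothesis.Theorems.KPlusLogSqLaw.ValDoor
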